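import Literature.AlgebraicGeometry.Resolution.ArithmeticalThreefoldsLocalDescentSteps
import Mathlib.FieldTheory.KummerPolynomial
import HarnessLib

/-!
# One step of tame descent reduced to its totally ramified Kummer core ([CoP1] Lemma 9.4, first half)

Topic: `Literature/AlgebraicGeometry/Resolution`. PROOF side of `CossartPiltant2019ReductionP`
(`ArithmeticalThreefoldsLocal.lean`). `ArithmeticalThreefoldsLocalDescentSteps.lean` reduced the
transfer input (C4) of the reduction `Thm. 1.5 ⇒ Thm. 1.1` to [CoP1] Lemma 9.4 (`hStep`: one
Galois step `A ≤ B` of prime degree `ℓ ≠ p`, `(LU B) ⇒ (LU A)`) and Prop. 9.3 (`hUnram`: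
unramified descent). The printed proof of Lemma 9.4 (HAL p. 29) begins with two reductions:

> We have `L = Kⁱ(W/V)` — in which case the lemma follows from proposition 9.3 (Galois case) —
> except if `s = f = p^d = 1, e = l` … Let `μ_l` be the group of `l`th-roots of unity … First
> assume that `μ_l ⊄ K`. Let `K′ := K(ζ_l)` and `L′ := L(ζ_l)` … `V` (resp. `W`) totally
> splits in `K′` (resp. `L′`). By corollary 6.3, `W′/k` has a local uniformization since `W`
> has. If `V′/k` has local uniformization, then `V` has local uniformization too by
> proposition 9.3 (Galois case). In other terms, it can be assumed that `μ_l ⊂ K`.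

after which `L = K(θ)` with `θ^l ∈ K` by Kummer theory and `G = Gⁱ(W/V) = ℤ/l`. This file proves
exactly these reductions in the climbing frame, leaving the TOTALLY RAMIFIED KUMMER CORE as the
hypothesis `hKummer`: for `ζ_ℓ ∈ A ∋ S`, `θ ∉ A` with `θ^ℓ ∈ A` and `v(θ) ≤ 1`, `N = A(θ)`
(Galois of degree `ℓ`) with inertia group ALL of `Gal(N|A)`, `(LU N) ⇒ (LU A)` — the second
half of the printed proof (the toric modification `S[y₁, y₂, y₃]` of a `G`-STABLE local
uniformization, whose local-algebra core is `exists_fixed_model_isRegularLocalRing`,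
`TameCyclicToricDescentModels.lean`, together with the reduction of an arbitrary local
uniformization upstairs to a `G`-stable one, "`S` is stable by `G`, since any conjugate of `S`
is dominated by `W`", which is the one step of the printed argument not yet a theorem of the
tree).

* `adjoin_rootSet_X_pow_sub_C_eq_adjoin_singleton`, `finrank_adjoin_singleton_eq_of_pow_mem` —
  PROVED: with `ζ_ℓ ∈ A`, `A(θ)` is the splitting field of `X^ℓ − θ^ℓ`, of degree `ℓ` when
  `θ ∉ A` (Kummer theory for one radical, `Mathlib.FieldTheory.KummerPolynomial`);
* `tameStep_descent_of_kummer` — PROVED: **`hStep` from cofinality, `hUnram` and `hKummer`**;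
* `descent_below_ramificationField_of_kummer` — PROVED: (C4) from cofinality, `hUnram`, `hKummer`;
* `cossartPiltant2019ReductionP_of_cjs_of_kummer` — PROVED:
  `CossartPiltant2019Local → CossartPiltant2019Principalization → CossartJannsenSaito2020General →
  (embedded resolution of surfaces) → (Kummer core of Lemma 9.4) → (Prop. 9.3) →
  CossartPiltant2019ReductionP`.

Everything is PROVED; no named facts are introduced.

## Sources

* V. Cossart, O. Piltant, J. Algebra 320 (2008) 1051–1082: Cor. 6.3, Prop. 9.3, Lemma 9.4 and
  its proof (HAL hal-00139124, pp. 18, 26–29). [CossartPiltant2008]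
* V. Cossart, O. Piltant, J. Algebra 529 (2019) 268–535 = arXiv:1412.0868, proof of Prop. 4.10
  (arXiv v1: Prop. 4.8, p. 54). [CossartPiltant2019]
-/

noncomputable section

open CategoryTheory AlgebraicGeometry TopologicalSpace IsLocalRing _root_.Polynomial
  _root_.IntermediateField

namespace Literature.AlgebraicGeometry.Resolution

universe u

/-! ## Kummer theory for one radical with `μ_ℓ` in the base -/

section Kummer

variable {E : Type u} [Field E]

/-- With `ζ_ℓ ∈ A` and `θ^ℓ = a`, `θ ≠ 0`: the field generated over `A` by ALL roots of
`X^ℓ − a` is `A(θ)` (the roots are the `ζ^i θ`). [folklore] -/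
private theorem adjoin_rootSet_X_pow_sub_C_eq_adjoin_singleton {ℓ : ℕ} (hℓ0 : ℓ ≠ 0) {ζ : E}
    (hζ : IsPrimitiveRoot ζ ℓ) {A : Subfield E} (hζA : ζ ∈ A) {a : A} {θ : E}
    (hθ : θ ^ ℓ = (a : E)) (hθ0 : θ ≠ 0) :
    adjoin A ((X ^ ℓ - C a : Polynomial A).rootSet E) = adjoin A ({θ} : Set E) := by
  apply le_antisymm
  · rw [IntermediateField.adjoin_le_iff]
    intro x hx
    obtain ⟨i, -, rfl⟩ := (mem_rootSet_X_pow_sub_C_iff hℓ0 hζ hθ hθ0 x).mp hx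
    change ζ ^ i * θ ∈ adjoin A ({θ} : Set E)
    exact mul_mem (pow_mem ((adjoin A ({θ} : Set E)).algebraMap_mem ⟨ζ, hζA⟩) i)
      (subset_adjoin A _ (Set.mem_singleton θ))
  · rw [IntermediateField.adjoin_le_iff, Set.singleton_subset_iff]
    exact subset_adjoin A _ ((mem_rootSet_X_pow_sub_C_iff hℓ0 hζ hθ hθ0 θ).mpr
      ⟨0, Nat.pos_of_ne_zero hℓ0, by rw [pow_zero, one_mul]⟩)

/-- **Kummer theory for one radical**: if `ℓ` is prime, `ζ_ℓ ∈ A`, `θ ∉ A` and `θ^ℓ ∈ A`, then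
`[A(θ) : A] = ℓ` (`X^ℓ − θ^ℓ` is irreducible over `A`, as `θ^ℓ` is not an `ℓ`-th power in `A`:
`b^ℓ = θ^ℓ` with `b ∈ A` would give `θ = ζ^i b ∈ A`).
[cite: CossartPiltant2008, proof of Lemma 9.4 (HAL p. 29) "`G := Gal(L/K) = Gi(W/V) = ℤ/l`"] -/
theorem finrank_adjoin_singleton_eq_of_pow_mem {ℓ : ℕ} (hℓ : ℓ.Prime) {ζ : E}
    (hζ : IsPrimitiveRoot ζ ℓ) {A : Subfield E} (hζA : ζ ∈ A) {θ : E} (hθA : θ ∉ A)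
    (hθℓ : θ ^ ℓ ∈ A) :
    Module.finrank A (adjoin A ({θ} : Set E)) = ℓ := by
  have hℓ0 : ℓ ≠ 0 := hℓ.ne_zero
  haveI : NeZero ℓ := ⟨hℓ0⟩
  have hθ0 : θ ≠ 0 := fun h => hθA (h ▸ A.zero_mem)
  let a : A := ⟨θ ^ ℓ, hθℓ⟩
  have ha : ∀ b : A, b ^ ℓ ≠ a := by
    intro b hb
    have hb' : (b : E) ^ ℓ = θ ^ ℓ := by
      have h := congrArg Subtype.val hb
      simpa [a] using h
    have hb0 : (b : E) ≠ 0 := by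
      intro h
      rw [h, zero_pow hℓ0] at hb'
      exact pow_ne_zero ℓ hθ0 hb'.symm
    have h1 : (θ / b) ^ ℓ = 1 := by rw [div_pow, ← hb', div_self (pow_ne_zero _ hb0)]
    obtain ⟨i, -, hi⟩ := hζ.eq_pow_of_pow_eq_one h1
    apply hθA
    have h2 : θ = ζ ^ i * b := by rw [hi, div_mul_cancel₀ _ hb0]
    rw [h2]
    exact A.mul_mem (A.pow_mem hζA i) b.2
  have hirr : Irreducible (X ^ ℓ - C a : Polynomial A) := X_pow_sub_C_irreducible_of_prime hℓ ha
  have hmon : (X ^ ℓ - C a : Polynomial A).Monic := monic_X_pow_sub_C a hℓ0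
  have haev : aeval θ (X ^ ℓ - C a : Polynomial A) = 0 := by
    simp only [map_sub, map_pow, aeval_X, aeval_C]
    change θ ^ ℓ - ((a : A) : E) = 0
    exact sub_self _
  have hmin : (X ^ ℓ - C a : Polynomial A) = minpoly A θ :=
    minpoly.eq_of_irreducible_of_monic hirr haev hmon
  have hint : IsIntegral A θ := ⟨X ^ ℓ - C a, hmon, by rwa [aeval_def] at haev⟩
  rw [adjoin.finrank hint, ← hmin, natDegree_X_pow_sub_C]

end Kummer

/-! ## Lemma 9.4 from its Kummer core -/

section Assembly

variable {S E : Type u} [CommRing S] [IsRegularLocalRing S] [Field E] [Algebra S E]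

/-- **[CoP1] Lemma 9.4 reduced to its totally ramified Kummer core.** Frame: `S` local of
residue characteristic `p` in an algebraically closed valued field `(E, O_E)` dominating it;
`(LU X)` for a subfield `X ∋ S` means a model `S[t] ⊆ O_E`, `t ⊆ X ⊆ Frac(S)(t)`, regular at
the centre. Hypotheses, at every subfield `∋ S`: cofinality of local uniformizations (`hCOF`,
[CoP1] Cor. 4.6), unramified descent (`hUnram`, [CoP1] Prop. 9.3: `(LU K′) ⇒ (LU M)` for
`M ≤ K′ ≤ Mⁱ`), and the KUMMER CORE (`hKummer`: for a prime `ℓ ≠ p`, a primitive `ℓ`-th root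
of unity `ζ ∈ A`, `θ ∉ A` with `θ^ℓ ∈ A` and `v(θ) ≤ 1`, `N = A(θ)` Galois of degree `ℓ` with
inertia group all of `Gal(N|A)`: `(LU N) ⇒ (LU A)`). Claim: `(LU B) ⇒ (LU A)` for every Galois
step `A ≤ B` of prime degree `ℓ ≠ p`. Proof (HAL p. 29, first paragraph): `v(ℓ) = 0`, so a
primitive `ζ = ζ_ℓ ∈ E` exists and `B(ζ) | B`, `A(ζ) | A` are unramified
(`inertiaGroupIn_eq_bot_adjoin_rootsOfUnity`); `(LU B) ⇒ (LU B(ζ))` by the étale climb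
(`exists_model_inertiaField_of_cofinal`, Cor. 6.3); `B(ζ) = A(ζ)(θ)` with `θ^ℓ ∈ A(ζ)`
(`exists_kummer_generator`, normalised to `v(θ) ≤ 1`); if `θ ∈ A(ζ)` there is nothing to do,
otherwise `A(ζ)(θ) | A(ζ)` is Galois of degree `ℓ` (`finrank_adjoin_singleton_eq_of_pow_mem`)
and its inertia group, a subgroup of a group of prime order, is trivial — `(LU A(ζ))` by
`hUnram` — or everything — `(LU A(ζ))` by `hKummer`; finally `(LU A(ζ)) ⇒ (LU A)` by `hUnram`.
[cite: CossartPiltant2008, Lemma 9.4 and its proof, first paragraph (HAL pp. 28–29)]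
[cite: CossartPiltant2008, Cor. 6.3, Prop. 9.3 (HAL pp. 18, 26)] -/
theorem tameStep_descent_of_kummer [IsAlgClosed E]
    (p : ℕ) (hp : p.Prime) (hSchar : CharP (ResidueField S) p)
    (OE : ValuationSubring E) (hSO : ∀ s : S, algebraMap S E s ∈ OE)
    (hdom : ∀ s ∈ maximalIdeal S, OE.valuation (algebraMap S E s) < 1)
    (hCOF : ∀ (M : Subfield E), (∀ s : S, algebraMap S E s ∈ M) →
      ∀ (t : Finset E), (t : Set E) ⊆ M →
        M ≤ Subfield.closure (Set.range (algebraMap S E) ∪ (t : Set E)) →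
      ∀ (hTO : (Algebra.adjoin S (t : Set E)).toSubring ≤ OE.toSubring),
        IsRegularLocalRing (Localization.AtPrime
          (Ideal.comap (Subring.inclusion hTO) (maximalIdeal OE))) →
      ∀ (c : Finset E), (c : Set E) ⊆ M → (∀ x ∈ c, x ∈ OE) →
      ∃ t' : Finset E, (t' : Set E) ⊆ M ∧
        M ≤ Subfield.closure (Set.range (algebraMap S E) ∪ (t' : Set E)) ∧
        ∃ hTO' : (Algebra.adjoin S (t' : Set E)).toSubring ≤ OE.toSubring,
          IsRegularLocalRing (Localization.AtPrime
            (Ideal.comap (Subring.inclusion hTO') (maximalIdeal OE))) ∧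
          ∀ x ∈ c, ∃ a s : E, a ∈ Algebra.adjoin S (t' : Set E) ∧
            s ∈ Algebra.adjoin S (t' : Set E) ∧ OE.valuation s = 1 ∧ x * s = a)
    (hUnram : ∀ (M : Subfield E), (∀ s : S, algebraMap S E s ∈ M) →
      ∀ (N : IntermediateField M E) [FiniteDimensional M N] [IsGalois M N] (K' : Subfield E),
        M ≤ K' → K' ≤ (lift (fixedField (inertiaGroupIn OE N))).toSubfield →
        (∃ t : Finset E, (t : Set E) ⊆ K' ∧
          K' ≤ Subfield.closure (Set.range (algebraMap S E) ∪ (t : Set E)) ∧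
          ∃ hTO : (Algebra.adjoin S (t : Set E)).toSubring ≤ OE.toSubring,
            IsRegularLocalRing (Localization.AtPrime
              (Ideal.comap (Subring.inclusion hTO) (maximalIdeal OE)))) →
        (∃ t : Finset E, (t : Set E) ⊆ M ∧
          M ≤ Subfield.closure (Set.range (algebraMap S E) ∪ (t : Set E)) ∧
          ∃ hTO : (Algebra.adjoin S (t : Set E)).toSubring ≤ OE.toSubring,
            IsRegularLocalRing (Localization.AtPrime
              (Ideal.comap (Subring.inclusion hTO) (maximalIdeal OE)))))
    (hKummer : ∀ (ℓ : ℕ), ℓ.Prime → ℓ ≠ p → ∀ (ζ : E), IsPrimitiveRoot ζ ℓ →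
      ∀ (A : Subfield E), (∀ s : S, algebraMap S E s ∈ A) → ζ ∈ A →
      ∀ (θ : E), θ ∉ A → θ ^ ℓ ∈ A → OE.valuation θ ≤ 1 →
        Module.finrank A (adjoin A ({θ} : Set E)) = ℓ → IsGalois A (adjoin A ({θ} : Set E)) →
        inertiaGroupIn OE (adjoin A ({θ} : Set E)) = ⊤ →
        (∃ t : Finset E, (t : Set E) ⊆ (adjoin A ({θ} : Set E)).toSubfield ∧
          (adjoin A ({θ} : Set E)).toSubfield ≤
            Subfield.closure (Set.range (algebraMap S E) ∪ (t : Set E)) ∧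
          ∃ hTO : (Algebra.adjoin S (t : Set E)).toSubring ≤ OE.toSubring,
            IsRegularLocalRing (Localization.AtPrime
              (Ideal.comap (Subring.inclusion hTO) (maximalIdeal OE)))) →
        (∃ t : Finset E, (t : Set E) ⊆ A ∧
          A ≤ Subfield.closure (Set.range (algebraMap S E) ∪ (t : Set E)) ∧
          ∃ hTO : (Algebra.adjoin S (t : Set E)).toSubring ≤ OE.toSubring,
            IsRegularLocalRing (Localization.AtPrime
              (Ideal.comap (Subring.inclusion hTO) (maximalIdeal OE)))))
    (A B : Subfield E) (hSA : ∀ s : S, algebraMap S E s ∈ A) (hstep : IsPrimeGaloisStep p A B)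
    (hLUB : ∃ t : Finset E, (t : Set E) ⊆ B ∧
      B ≤ Subfield.closure (Set.range (algebraMap S E) ∪ (t : Set E)) ∧
      ∃ hTO : (Algebra.adjoin S (t : Set E)).toSubring ≤ OE.toSubring,
        IsRegularLocalRing (Localization.AtPrime
          (Ideal.comap (Subring.inclusion hTO) (maximalIdeal OE)))) :
    ∃ t : Finset E, (t : Set E) ⊆ A ∧
      A ≤ Subfield.closure (Set.range (algebraMap S E) ∪ (t : Set E)) ∧
      ∃ hTO : (Algebra.adjoin S (t : Set E)).toSubring ≤ OE.toSubring,
        IsRegularLocalRing (Localization.AtPrime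
          (Ideal.comap (Subring.inclusion hTO) (maximalIdeal OE))) := by
  classical
  obtain ⟨hAB, ℓ, hℓ, hℓp, hfin, hgal⟩ := hstep
  haveI : Fact p.Prime := ⟨hp⟩
  haveI : Fact ℓ.Prime := ⟨hℓ⟩
  have hℓ0 : ℓ ≠ 0 := hℓ.ne_zero
  haveI : NeZero ℓ := ⟨hℓ0⟩
  have hSB : ∀ s : S, algebraMap S E s ∈ B := fun s => hAB (hSA s)
  -- residue characteristic and `v(ℓ) = 1`
  haveI hchar : CharP (ResidueField OE) p :=
    charP_residueField_valuationSubring_of_dominates OE p hSchar hSO hdom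
  have hvℓ : OE.valuation (ℓ : E) = 1 := by
    have hres0 : (ℓ : ResidueField OE) ≠ 0 := by
      intro h0
      have h1 : p ∣ ℓ := (CharP.cast_eq_zero_iff (ResidueField OE) p ℓ).mp h0
      exact hℓp ((Nat.prime_dvd_prime_iff_eq hp hℓ).mp h1).symm
    have hnotmem : (ℓ : OE) ∉ maximalIdeal OE := fun hmem => hres0 (by
      rw [← map_natCast (IsLocalRing.residue OE) ℓ, IsLocalRing.residue_eq_zero_iff]
      exact hmem)
    have h1 : OE.valuation ((ℓ : OE) : E) = 1 := by
      have hle : OE.valuation ((ℓ : OE) : E) ≤ 1 := (OE.valuation_le_one_iff _).mpr (ℓ : OE).2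
      have hnlt : ¬ OE.valuation ((ℓ : OE) : E) < 1 := fun hlt =>
        hnotmem ((ValuationSubring.valuation_lt_one_iff OE _).mpr hlt)
      exact le_antisymm hle (not_lt.mp hnlt)
    rwa [show ((ℓ : OE) : E) = (ℓ : E) from map_natCast OE.subtype ℓ] at h1
  have hℓE : (ℓ : E) ≠ 0 := fun h0 => by rw [h0, map_zero] at hvℓ; exact zero_ne_one hvℓ
  -- a primitive `ℓ`-th root of unity
  obtain ⟨ζ, hζ⟩ : ∃ ζ : E, IsPrimitiveRoot ζ ℓ := by
    haveI : NeZero (ℓ : E) := ⟨hℓE⟩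
    have hdeg : (cyclotomic ℓ E).degree ≠ 0 := by
      rw [degree_cyclotomic, Nat.totient_prime hℓ]
      exact_mod_cast Nat.sub_ne_zero_of_lt hℓ.one_lt
    obtain ⟨ζ, hζ⟩ := IsAlgClosed.exists_root (cyclotomic ℓ E) hdeg
    exact ⟨ζ, (isRoot_cyclotomic_iff).mp hζ⟩
  have hvζ : OE.valuation ζ = 1 := by
    have h1 : OE.valuation ζ ^ ℓ = 1 := by rw [← map_pow, hζ.pow_eq_one, map_one]
    rcases pow_eq_one_iff.mp h1 with h | h
    · exact h
    · exact absurd h hℓ0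
  /- Step 1 (Cor. 6.3): `(LU B) ⇒ (LU B(ζ))`, `B(ζ) | B` being unramified -/
  let Bc : Subfield E := Subfield.closure ((B : Set E) ∪ {ζ})
  let NB : IntermediateField B E := adjoin B ((X ^ ℓ - C (1 : B) : Polynomial B).rootSet E)
  obtain ⟨hsepB, hsplB⟩ := separable_and_splits_X_pow_sub_C (M := B) hℓE (one_ne_zero)
  obtain ⟨hGalNB, hfinNB⟩ := isGalois_and_finiteDimensional_adjoin_rootSet (M := B) hsepB hsplB
  haveI := hGalNB
  haveI := hfinNB
  have hNBsub : NB.toSubfield = Bc := toSubfield_adjoin_rootSet_X_pow_sub_one hℓ0 hζ B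
  have hinNB : inertiaGroupIn OE NB = ⊥ := inertiaGroupIn_eq_bot_adjoin_rootsOfUnity OE hℓ0 hvℓ hζ NB rfl
  have hLUBc : ∃ t : Finset E, (t : Set E) ⊆ Bc ∧
      Bc ≤ Subfield.closure (Set.range (algebraMap S E) ∪ (t : Set E)) ∧
      ∃ hTO : (Algebra.adjoin S (t : Set E)).toSubring ≤ OE.toSubring,
        IsRegularLocalRing (Localization.AtPrime
          (Ideal.comap (Subring.inclusion hTO) (maximalIdeal OE))) := by
    have h1 := exists_model_inertiaField_of_cofinal OE B NB (fun M' hM' => hCOF M' (by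
      rcases hM' with rfl | rfl
      · exact hSB
      · intro s
        exact (lift (fixedField (decompositionGroupIn OE NB))).algebraMap_mem
          (⟨algebraMap S E s, hSB s⟩ : B))) hLUB
    rw [(lift_fixedField_eq_of_inertiaGroupIn_eq_bot OE NB hinNB).1, hNBsub] at h1
    exact h1
  /- Step 2: the Kummer generator of `B(ζ) = A(ζ)(θ)`, normalised to `v(θ) ≤ 1` -/
  let A' : Subfield E := Subfield.closure ((A : Set E) ∪ {ζ})
  have hAA' : A ≤ A' := fun x hx => Subfield.subset_closure (Or.inl hx)
  have hζA' : ζ ∈ A' := Subfield.subset_closure (Or.inr rfl)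
  have hSA' : ∀ s : S, algebraMap S E s ∈ A' := fun s => hAA' (hSA s)
  obtain ⟨θ₀, hθ₀0, hθ₀ℓ, hBcl₀, hθ₀B⟩ := exists_kummer_generator A B hAB hℓ hℓE hfin hgal hζ
  have hBBc : B ≤ Bc := fun x hx => Subfield.subset_closure (Or.inl hx)
  have hA'Bc : A' ≤ Bc := Subfield.closure_mono (Set.union_subset_union_left _ hAB)
  obtain ⟨θ, hθ0, hθℓ, hBcl, hθB, hvθ⟩ : ∃ θ : E, θ ≠ 0 ∧ θ ^ ℓ ∈ A' ∧
      B ≤ Subfield.closure ((A' : Set E) ∪ {θ}) ∧ θ ∈ Bc ∧ OE.valuation θ ≤ 1 := by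
    by_cases hv : OE.valuation θ₀ ≤ 1
    · exact ⟨θ₀, hθ₀0, hθ₀ℓ, hBcl₀, hθ₀B, hv⟩
    · refine ⟨θ₀⁻¹, inv_ne_zero hθ₀0, ?_, ?_, Bc.inv_mem hθ₀B, ?_⟩
      · rw [inv_pow]; exact A'.inv_mem hθ₀ℓ
      · refine hBcl₀.trans (Subfield.closure_le.mpr ?_)
        rintro x (hx | hx)
        · exact Subfield.subset_closure (Or.inl hx)
        · rw [Set.mem_singleton_iff.mp hx]
          have : θ₀⁻¹ ∈ Subfield.closure ((A' : Set E) ∪ {θ₀⁻¹}) :=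
            Subfield.subset_closure (Or.inr rfl)
          have h2 := Subfield.inv_mem _ this
          rwa [inv_inv] at h2
      · rw [map_inv₀]
        exact (inv_lt_one₀ (lt_of_lt_of_le zero_lt_one (not_le.mp hv).le)).mpr (not_le.mp hv) |>.le
  let B' : Subfield E := Subfield.closure ((A' : Set E) ∪ {θ})
  have hA'B' : A' ≤ B' := fun x hx => Subfield.subset_closure (Or.inl hx)
  have hθB' : θ ∈ B' := Subfield.subset_closure (Or.inr rfl)
  have hBB' : B ≤ B' := hBcl
  have hB'Bc : B' ≤ Bc := Subfield.closure_le.mpr (by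
    rintro x (hx | hx)
    · exact hA'Bc hx
    · rw [Set.mem_singleton_iff.mp hx]; exact hθB)
  have hBcB' : Bc ≤ B' := Subfield.closure_le.mpr (by
    rintro x (hx | hx)
    · exact hBB' hx
    · rw [Set.mem_singleton_iff.mp hx]; exact hA'B' hζA')
  have hB'eq : B' = Bc := le_antisymm hB'Bc hBcB'
  -- `B′ = A′⟮θ⟯` as the subfield of an intermediate field over `A′`
  have hB'adj : (adjoin A' ({θ} : Set E)).toSubfield = B' := by
    change Subfield.closure (Set.range (algebraMap A' E) ∪ {θ}) = _
    rw [show Set.range (algebraMap A' E) = (A' : Set E) from Subtype.range_coe]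
  have hLUB' : ∃ t : Finset E, (t : Set E) ⊆ (adjoin A' ({θ} : Set E)).toSubfield ∧
      (adjoin A' ({θ} : Set E)).toSubfield ≤
        Subfield.closure (Set.range (algebraMap S E) ∪ (t : Set E)) ∧
      ∃ hTO : (Algebra.adjoin S (t : Set E)).toSubring ≤ OE.toSubring,
        IsRegularLocalRing (Localization.AtPrime
          (Ideal.comap (Subring.inclusion hTO) (maximalIdeal OE))) := by
    rw [hB'adj, hB'eq]
    exact hLUBc
  /- Step 3: `(LU A′⟮θ⟯) ⇒ (LU A′)` -/
  have hLUA' : ∃ t : Finset E, (t : Set E) ⊆ A' ∧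
      A' ≤ Subfield.closure (Set.range (algebraMap S E) ∪ (t : Set E)) ∧
      ∃ hTO : (Algebra.adjoin S (t : Set E)).toSubring ≤ OE.toSubring,
        IsRegularLocalRing (Localization.AtPrime
          (Ideal.comap (Subring.inclusion hTO) (maximalIdeal OE))) := by
    by_cases hθA' : θ ∈ A'
    · -- `B′ = A′`
      have hB'A' : B' ≤ A' := Subfield.closure_le.mpr (by
        rintro x (hx | hx)
        · exact hx
        · rw [Set.mem_singleton_iff.mp hx]; exact hθA')
      have heq : (adjoin A' ({θ} : Set E)).toSubfield = A' := by
        rw [hB'adj]; exact le_antisymm hB'A' hA'B'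
      rw [heq] at hLUB'
      exact hLUB'
    · -- `A′⟮θ⟯ | A′` is Galois of degree `ℓ`
      let N' : IntermediateField A' E := adjoin A' ({θ} : Set E)
      have hfin' : Module.finrank A' N' = ℓ :=
        finrank_adjoin_singleton_eq_of_pow_mem hℓ hζ hζA' hθA' hθℓ
      let a : A' := ⟨θ ^ ℓ, hθℓ⟩
      have ha0 : a ≠ 0 := fun h => pow_ne_zero ℓ hθ0 (congrArg Subtype.val h)
      obtain ⟨hsepA, hsplA⟩ := separable_and_splits_X_pow_sub_C (M := A') hℓE ha0
      obtain ⟨hGalN, hfinN⟩ := isGalois_and_finiteDimensional_adjoin_rootSet (M := A') hsepA hsplA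
      have hNeq : adjoin A' ((X ^ ℓ - C a : Polynomial A').rootSet E) = N' :=
        adjoin_rootSet_X_pow_sub_C_eq_adjoin_singleton hℓ0 hζ hζA' (a := a) rfl hθ0
      rw [hNeq] at hGalN hfinN
      haveI : IsGalois A' N' := hGalN
      haveI : FiniteDimensional A' N' := hfinN
      -- the inertia group is trivial or everything
      haveI : Fact (Nat.card (N' ≃ₐ[A'] N')).Prime := ⟨by
        rw [IsGalois.card_aut_eq_finrank, hfin']; exact hℓ⟩
      rcases (inertiaGroupIn OE N').eq_bot_or_eq_top_of_prime_card with hbot | htop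
      · -- unramified: Prop. 9.3
        refine hUnram A' hSA' N' _ (subfield_le_toSubfield _) ?_ hLUB'
        rw [(lift_fixedField_eq_of_inertiaGroupIn_eq_bot OE N' hbot).1]
      · -- totally ramified: the Kummer core
        exact hKummer ℓ hℓ hℓp ζ hζ A' hSA' hζA' θ hθA' hθℓ hvθ hfin' hGalN htop hLUB'
  /- Step 4 (Prop. 9.3): `(LU A′) ⇒ (LU A)`, `A(ζ) | A` being unramified -/
  let NA : IntermediateField A E := adjoin A ((X ^ ℓ - C (1 : A) : Polynomial A).rootSet E)
  obtain ⟨hsepA1, hsplA1⟩ := separable_and_splits_X_pow_sub_C (M := A) hℓE (one_ne_zero)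
  obtain ⟨hGalNA, hfinNA⟩ := isGalois_and_finiteDimensional_adjoin_rootSet (M := A) hsepA1 hsplA1
  haveI := hGalNA
  haveI := hfinNA
  have hNAsub : NA.toSubfield = A' := toSubfield_adjoin_rootSet_X_pow_sub_one hℓ0 hζ A
  have hinNA : inertiaGroupIn OE NA = ⊥ := inertiaGroupIn_eq_bot_adjoin_rootsOfUnity OE hℓ0 hvℓ hζ NA rfl
  refine hUnram A hSA NA A' hAA' ?_ hLUA'
  rw [(lift_fixedField_eq_of_inertiaGroupIn_eq_bot OE NA hinNA).1, hNAsub]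

/-- **(C4) from cofinality, unramified descent and the Kummer core**:
`descent_below_ramificationField_of_steps` with `hStep` discharged by
`tameStep_descent_of_kummer`.
[cite: CossartPiltant2008, Props. 9.3, 9.5 and Lemma 9.4 (HAL pp. 26–30)] -/
theorem descent_below_ramificationField_of_kummer [IsAlgClosed E]
    (p : ℕ) (hp : p.Prime) (hSchar : CharP (ResidueField S) p)
    (OE : ValuationSubring E) (hSO : ∀ s : S, algebraMap S E s ∈ OE)
    (hdom : ∀ s ∈ maximalIdeal S, OE.valuation (algebraMap S E s) < 1)
    (hCOF : ∀ (M : Subfield E), (∀ s : S, algebraMap S E s ∈ M) →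
      ∀ (t : Finset E), (t : Set E) ⊆ M →
        M ≤ Subfield.closure (Set.range (algebraMap S E) ∪ (t : Set E)) →
      ∀ (hTO : (Algebra.adjoin S (t : Set E)).toSubring ≤ OE.toSubring),
        IsRegularLocalRing (Localization.AtPrime
          (Ideal.comap (Subring.inclusion hTO) (maximalIdeal OE))) →
      ∀ (c : Finset E), (c : Set E) ⊆ M → (∀ x ∈ c, x ∈ OE) →
      ∃ t' : Finset E, (t' : Set E) ⊆ M ∧
        M ≤ Subfield.closure (Set.range (algebraMap S E) ∪ (t' : Set E)) ∧
        ∃ hTO' : (Algebra.adjoin S (t' : Set E)).toSubring ≤ OE.toSubring,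
          IsRegularLocalRing (Localization.AtPrime
            (Ideal.comap (Subring.inclusion hTO') (maximalIdeal OE))) ∧
          ∀ x ∈ c, ∃ a s : E, a ∈ Algebra.adjoin S (t' : Set E) ∧
            s ∈ Algebra.adjoin S (t' : Set E) ∧ OE.valuation s = 1 ∧ x * s = a)
    (hUnram : ∀ (M : Subfield E), (∀ s : S, algebraMap S E s ∈ M) →
      ∀ (N : IntermediateField M E) [FiniteDimensional M N] [IsGalois M N] (K' : Subfield E),
        M ≤ K' → K' ≤ (lift (fixedField (inertiaGroupIn OE N))).toSubfield →
        (∃ t : Finset E, (t : Set E) ⊆ K' ∧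
          K' ≤ Subfield.closure (Set.range (algebraMap S E) ∪ (t : Set E)) ∧
          ∃ hTO : (Algebra.adjoin S (t : Set E)).toSubring ≤ OE.toSubring,
            IsRegularLocalRing (Localization.AtPrime
              (Ideal.comap (Subring.inclusion hTO) (maximalIdeal OE)))) →
        (∃ t : Finset E, (t : Set E) ⊆ M ∧
          M ≤ Subfield.closure (Set.range (algebraMap S E) ∪ (t : Set E)) ∧
          ∃ hTO : (Algebra.adjoin S (t : Set E)).toSubring ≤ OE.toSubring,
            IsRegularLocalRing (Localization.AtPrime
              (Ideal.comap (Subring.inclusion hTO) (maximalIdeal OE)))))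
    (hKummer : ∀ (ℓ : ℕ), ℓ.Prime → ℓ ≠ p → ∀ (ζ : E), IsPrimitiveRoot ζ ℓ →
      ∀ (A : Subfield E), (∀ s : S, algebraMap S E s ∈ A) → ζ ∈ A →
      ∀ (θ : E), θ ∉ A → θ ^ ℓ ∈ A → OE.valuation θ ≤ 1 →
        Module.finrank A (adjoin A ({θ} : Set E)) = ℓ → IsGalois A (adjoin A ({θ} : Set E)) →
        inertiaGroupIn OE (adjoin A ({θ} : Set E)) = ⊤ →
        (∃ t : Finset E, (t : Set E) ⊆ (adjoin A ({θ} : Set E)).toSubfield ∧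
          (adjoin A ({θ} : Set E)).toSubfield ≤
            Subfield.closure (Set.range (algebraMap S E) ∪ (t : Set E)) ∧
          ∃ hTO : (Algebra.adjoin S (t : Set E)).toSubring ≤ OE.toSubring,
            IsRegularLocalRing (Localization.AtPrime
              (Ideal.comap (Subring.inclusion hTO) (maximalIdeal OE)))) →
        (∃ t : Finset E, (t : Set E) ⊆ A ∧
          A ≤ Subfield.closure (Set.range (algebraMap S E) ∪ (t : Set E)) ∧
          ∃ hTO : (Algebra.adjoin S (t : Set E)).toSubring ≤ OE.toSubring,
            IsRegularLocalRing (Localization.AtPrime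
              (Ideal.comap (Subring.inclusion hTO) (maximalIdeal OE)))))
    (M : Subfield E) (hSM : ∀ s : S, algebraMap S E s ∈ M)
    (N : IntermediateField M E) [FiniteDimensional M N] [IsGalois M N] (K' : Subfield E)
    (hMK' : M ≤ K') (hK'r : K' ≤ (lift (fixedField (ramificationGroupIn OE N))).toSubfield)
    (hLUK' : ∃ t : Finset E, (t : Set E) ⊆ K' ∧
      K' ≤ Subfield.closure (Set.range (algebraMap S E) ∪ (t : Set E)) ∧
      ∃ hTO : (Algebra.adjoin S (t : Set E)).toSubring ≤ OE.toSubring,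
        IsRegularLocalRing (Localization.AtPrime
          (Ideal.comap (Subring.inclusion hTO) (maximalIdeal OE)))) :
    ∃ t : Finset E, (t : Set E) ⊆ M ∧
      M ≤ Subfield.closure (Set.range (algebraMap S E) ∪ (t : Set E)) ∧
      ∃ hTO : (Algebra.adjoin S (t : Set E)).toSubring ≤ OE.toSubring,
        IsRegularLocalRing (Localization.AtPrime
          (Ideal.comap (Subring.inclusion hTO) (maximalIdeal OE))) :=
  descent_below_ramificationField_of_steps p hp hSchar OE hSO hdom hCOF
    (fun A B hSA hstep hLUB =>
      tameStep_descent_of_kummer p hp hSchar OE hSO hdom hCOF hUnram hKummer A B hSA hstep hLUB)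
    hUnram M hSM N K' hMK' hK'r hLUK'

end Assembly

/-! ## The reduction with (C4) reduced to unramified descent and the Kummer core -/

/-- **Cossart–Piltant 2019, Prop. 4.10 from Thm. 1.5, principalization, resolution of excellent
surfaces (embedded and non-embedded), unramified descent and the totally ramified Kummer core of
tame descent**: `cossartPiltant2019ReductionP_of_cjs_of_steps` with the tame step ([CoP1]
Lemma 9.4) discharged down to its Kummer core by `tameStep_descent_of_kummer`. The remaining
analytic inputs of the printed reduction `Thm. 1.5 ⇒ Thm. 1.1`, besides the local theorem,
principalization (Prop. 4.4) and resolution of surfaces (CJS 2020 Thm. 1.2, Cor. 1.5), are now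
[CoP1] Prop. 9.3 (`hUnram`) and the second half of the proof of [CoP1] Lemma 9.4 (`hKummer`),
both for rank-one valuations of an algebraically closed valued field dominating the complete
regular local base `S` with algebraic residue field extension.
[cite: CossartPiltant2019, Props. 4.3, 4.4 and proof of Prop. 4.10 (arXiv v1: Props. 4.2, 4.3, 4.8, pp. 50–54)]
[cite: CossartPiltant2008, Lemma 9.4, Prop. 9.3, Prop. 9.5 (HAL pp. 26–30)]
[cite: CossartJannsenSaito2020, Thm. 1.2, Cor. 1.5] -/
theorem cossartPiltant2019ReductionP_of_cjs_of_kummer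
    (hloc : CossartPiltant2019Local.{u}) (h44 : CossartPiltant2019Principalization.{u})
    (hCJS : CossartJannsenSaito2020General.{u})
    (hEmb : ∀ (Z : Scheme.{u}) [IsIntegral Z] [IsNoetherian Z], Scheme.IsRegular Z →
      Scheme.IsExcellent Z → ∀ (X : Set Z), IsClosed X → X ≠ Set.univ → topologicalKrullDim X ≤ 2 →
        ∃ (Z' : Scheme.{u}) (π : Z' ⟶ Z), IsProper π ∧ Function.Surjective π.base ∧
          (∃ U : Z.Opens, (U : Set Z) = Xᶜ ∧ IsIso (π ∣_ U)) ∧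
          IsStrictNormalCrossingsDivisor Z' (π.base ⁻¹' X))
    (hKummer :
      ∀ (p : ℕ), p.Prime →
      ∀ (S : Type u) [CommRing S] [IsDomain S] [IsRegularLocalRing S],
        IsExcellentRing S → ringKrullDim S = 3 → CharP (ResidueField S) p →
        IsAdicComplete (maximalIdeal S) S →
      ∀ (E : Type u) [Field E] [Algebra S E], Function.Injective (algebraMap S E) →
        IsAlgClosed E → Algebra.IsAlgebraic S E →
      ∀ (OE : ValuationSubring E), (∀ s : S, algebraMap S E s ∈ OE) →
        (∀ s ∈ maximalIdeal S, OE.valuation (algebraMap S E s) < 1) →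
        (∀ y : OE, ∃ q : S[X], (∃ i, q.coeff i ∉ maximalIdeal S) ∧
          OE.valuation (q.eval₂ (algebraMap S E) y) < 1) →
      Nonempty OE.valuation.RankOne →
      ∀ (ℓ : ℕ), ℓ.Prime → ℓ ≠ p → ∀ (ζ : E), IsPrimitiveRoot ζ ℓ →
      ∀ (A : Subfield E), (∀ s : S, algebraMap S E s ∈ A) → ζ ∈ A →
      ∀ (θ : E), θ ∉ A → θ ^ ℓ ∈ A → OE.valuation θ ≤ 1 →
        Module.finrank A (adjoin A ({θ} : Set E)) = ℓ → IsGalois A (adjoin A ({θ} : Set E)) →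
        inertiaGroupIn OE (adjoin A ({θ} : Set E)) = ⊤ →
        (∃ t : Finset E, (t : Set E) ⊆ (adjoin A ({θ} : Set E)).toSubfield ∧
          (adjoin A ({θ} : Set E)).toSubfield ≤
            Subfield.closure (Set.range (algebraMap S E) ∪ (t : Set E)) ∧
          ∃ hTO : (Algebra.adjoin S (t : Set E)).toSubring ≤ OE.toSubring,
            IsRegularLocalRing (Localization.AtPrime
              (Ideal.comap (Subring.inclusion hTO) (maximalIdeal OE)))) →
        (∃ t : Finset E, (t : Set E) ⊆ A ∧
          A ≤ Subfield.closure (Set.range (algebraMap S E) ∪ (t : Set E)) ∧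
          ∃ hTO : (Algebra.adjoin S (t : Set E)).toSubring ≤ OE.toSubring,
            IsRegularLocalRing (Localization.AtPrime
              (Ideal.comap (Subring.inclusion hTO) (maximalIdeal OE)))))
    (hUnram :
      ∀ (p : ℕ), p.Prime →
      ∀ (S : Type u) [CommRing S] [IsDomain S] [IsRegularLocalRing S],
        IsExcellentRing S → ringKrullDim S = 3 → CharP (ResidueField S) p →
        IsAdicComplete (maximalIdeal S) S →
      ∀ (E : Type u) [Field E] [Algebra S E], Function.Injective (algebraMap S E) →
        IsAlgClosed E → Algebra.IsAlgebraic S E →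
      ∀ (OE : ValuationSubring E), (∀ s : S, algebraMap S E s ∈ OE) →
        (∀ s ∈ maximalIdeal S, OE.valuation (algebraMap S E s) < 1) →
        (∀ y : OE, ∃ q : S[X], (∃ i, q.coeff i ∉ maximalIdeal S) ∧
          OE.valuation (q.eval₂ (algebraMap S E) y) < 1) →
      Nonempty OE.valuation.RankOne →
      ∀ (M : Subfield E), (∀ s : S, algebraMap S E s ∈ M) →
      ∀ (N : IntermediateField M E) [FiniteDimensional M N] [IsGalois M N] (K' : Subfield E),
        M ≤ K' → K' ≤ (lift (fixedField (inertiaGroupIn OE N))).toSubfield →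
        (∃ t : Finset E, (t : Set E) ⊆ K' ∧
          K' ≤ Subfield.closure (Set.range (algebraMap S E) ∪ (t : Set E)) ∧
          ∃ hTO : (Algebra.adjoin S (t : Set E)).toSubring ≤ OE.toSubring,
            IsRegularLocalRing (Localization.AtPrime
              (Ideal.comap (Subring.inclusion hTO) (maximalIdeal OE)))) →
        (∃ t : Finset E, (t : Set E) ⊆ M ∧
          M ≤ Subfield.closure (Set.range (algebraMap S E) ∪ (t : Set E)) ∧
          ∃ hTO : (Algebra.adjoin S (t : Set E)).toSubring ≤ OE.toSubring,
            IsRegularLocalRing (Localization.AtPrime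
              (Ideal.comap (Subring.inclusion hTO) (maximalIdeal OE))))) :
    CossartPiltant2019ReductionP.{u} :=
  cossartPiltant2019ReductionP_of_cjs_of_steps hloc h44 hCJS hEmb
    (fun p hp S _ _ _ hS hSdim hSchar hScomp E _ _ hinj hE halg OE hSO hdom hres hrk A B hSA hstep
        hLUB => by
      haveI := hE
      haveI := halg
      exact tameStep_descent_of_kummer p hp hSchar OE hSO hdom
        (cofinality_of_principalization h44 p hp S hS hSdim hSchar hScomp E hinj hE halg OE hSO hdom
          hres)
        (fun M' hSM' N' _ _ => hUnram p hp S hS hSdim hSchar hScomp E hinj hE halg OE hSO hdom hres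
          hrk M' hSM' N')
        (hKummer p hp S hS hSdim hSchar hScomp E hinj hE halg OE hSO hdom hres hrk) A B hSA hstep hLUB)
    hUnram

end Literature.AlgebraicGeometry.Resolution

end
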